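import Literature.NumberTheory.Transcendental.KZCalculus
import Literature.NumberTheory.Transcendental.KZSemialgebraicComplex
import HarnessLib

/-!
# The dimension-truncated Kontsevich–Zagier calculus: `relationsLE d`, `EquivalentLE`, `ChainLE`

Extension of `Literature/NumberTheory/Transcendental/KZCalculus.lean` (namespace
`Literature.NumberTheory.Transcendental.KZ`). Kontsevich–Zagier [KZ 2001, §1.2] list three rules
(additivity, change of variables, Newton–Leibniz/Stokes) by which one passes between two integral
representations of the same period, and conjecture (Conjecture 1) that they always suffice; in
Problem 2 of the same section they propose to measure the *simplicity* of a period "in terms of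
the dimension of the integral defining the period and the complexity of the polynomials" (or "the
amount of ink"). The fixed calculus of `KZCalculus.lean` (`FormalRep`, the four move sets
`domainAddRel`, `integrandAddRel`, `changeOfVariablesRel`, `newtonLeibnizRel`, `relations`,
`Equivalent`) is filtered by the **ambient dimension** of the representations a move instance
involves. This file names that filtration, exactly in the terms inlined by route
`KontsevichZagierPeriods/DimensionBudget` (and `…/DessinsDimensionOne`), so that those items restate
by `Iff.rfl`:

* `KZ.formalRepLE d` — the subgroup of `FormalRep` generated by the representations of dimension
  `≤ d`;
* `KZ.movesLE d` — the move instances (elements of the four move sets) lying in `formalRepLE d`,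
  i.e. all of whose representations have dimension `≤ d` (a Newton–Leibniz instance between
  dimensions `n + 1` and `n` lies in `movesLE d` as soon as `n + 1 ≤ d`; by freeness of
  `FormalRep` this is also necessary);
* `KZ.relationsLE d` — the subgroup generated by `movesLE d` (the *truncated relations*);
* `KZ.EquivalentLE d r r'` — `[r] − [r'] ∈ relationsLE d`;
* `KZ.ChainLE d ℓ c` — `c` is a sum of at most `ℓ` signed move instances from `movesLE d`
  (tree-like proof length `≤ ℓ` inside dimension `≤ d`).

## Main statements (all proved)

* `KZ.relationsLE_mono`, `KZ.relationsLE_le_relations`, `KZ.relationsLE_le_formalRepLE`;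
* `KZ.relations_eq_iSup_relationsLE` — **exhaustion**: `relations = ⨆ d, relationsLE d` (every
  move instance is supported in the dimension of its representations), and its membership forms
  `KZ.mem_relations_iff_exists_mem_relationsLE`, `KZ.equivalent_iff_exists_equivalentLE`;
* `KZ.mem_relationsLE_iff_exists_chainLE` — the closure is the union of the word-length balls;
* `KZ.IntegralRep.constMul`, `KZ.scale` — the scaling endomorphism of `FormalRep` (all integrands
  multiplied by a real algebraic constant `a`) and `KZ.scale_mem_movesLE`,
  `KZ.scale_mem_relationsLE`, `KZ.scale_mem_relations`, `KZ.eval_scale`: it preserves every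
  move set, every `movesLE d`, hence every `relationsLE d`, and multiplies values by `a`;
* `KZ.EquivalentLE.refl/symm/trans/mono/equivalent/constMul`, `KZ.ChainLE.*` (monotonicity,
  `add`, `neg`, `sub`, `scale`, `mem_relationsLE`).

## References

* M. Kontsevich, D. Zagier, *Periods*, in: Mathematics Unlimited — 2001 and Beyond, Springer
  (2001), §1.2 (rules (1)–(3), Conjecture 1, Problems 1–2).
* J. Ayoub, *Une version relative de la conjecture des périodes de Kontsevich–Zagier*, Ann. of
  Math. 181 (2015), Rem. 1.2 and Rem. 1.5 (on the number of variables a proof by the rules may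
  need; locator as supplied by the requesting route).

## Design notes

* The truncation is a construction on the fixed calculus of `KZCalculus.lean`, not a notion printed
  by Kontsevich–Zagier; the docstrings cite KZ §1.2 for the rules and for "dimension of the
  integral" as the measure of size (Problem 2), and are otherwise marked as the route's
  construction.
* `formalRepLE`, `movesLE`, `relationsLE`, `ChainLE` are *literally* the sub-terms inlined in the
  signatures of route DimensionBudget (`AddSubgroup.closure ((domainAddRel ∪ integrandAddRel ∪
  changeOfVariablesRel ∪ newtonLeibnizRel) ∩ (AddSubgroup.closure {x | ∃ k s, k ≤ d ∧ x = of s} :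
  Set FormalRep))`, `∃ l : List FormalRep, l.length ≤ ℓ ∧ (∀ e ∈ l, e ∈ _ ∨ -e ∈ _) ∧ l.sum = c`),
  kept as plain `def`s so that `Iff.rfl` / `rfl` restate those items.
* The scaling constant is taken real algebraic (`IsAlgebraic ℚ a`), which is what makes the scaled
  integrands and primitives again `ℚ`-semialgebraic
  (`isSemialgebraicFunOn_const_of_isAlgebraic`, `IsSemialgebraicFunOn.mul_holds`); `a = 0` is
  allowed (no invertibility is claimed).
-/

noncomputable section

open MeasureTheory Set
open scoped Pointwise

namespace Literature.NumberTheory.Transcendental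

namespace KZ

variable {n m l : ℕ}

/-! ### The dimension filtration -/

/-- The formal combinations supported on representations of dimension `≤ d`: the subgroup of
`FormalRep` generated by the generators `of s`, `s : IntegralRep k`, `k ≤ d`. (KZ measure the size
of an integral representation first of all by "the dimension of the integral", §1.2, Problem 2;
the truncation itself is the construction of route KontsevichZagierPeriods/DimensionBudget.)
[cite: KontsevichZagier2001, §1.2 Problem 2] -/
def formalRepLE (d : ℕ) : AddSubgroup FormalRep :=
  AddSubgroup.closure {x : FormalRep | ∃ (k : ℕ) (s : IntegralRep k), k ≤ d ∧ x = of s}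

/-- The move instances of the KZ calculus supported in dimension `≤ d`: elements of one of the four
move sets (rules (1a), (1b), (2), (3) of `KZCalculus.lean`) which lie in `formalRepLE d`, i.e. all
of whose representations have dimension `≤ d`. A Newton–Leibniz instance `[r] − [r']` between
dimensions `n + 1` and `n` lies in `movesLE d` as soon as `n + 1 ≤ d`
(`mem_movesLE_of_mem_newtonLeibnizRel`; by freeness of `FormalRep` this is also necessary).
[cite: KontsevichZagier2001, §1.2 rules (1)-(3)] -/
def movesLE (d : ℕ) : Set FormalRep :=
  (domainAddRel ∪ integrandAddRel ∪ changeOfVariablesRel ∪ newtonLeibnizRel) ∩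
    (formalRepLE d : Set FormalRep)

/-- The **truncated relations** `relations_≤d`: the subgroup of `FormalRep` generated by the move
instances supported in dimension `≤ d`. The quotient `formalRepLE d ⧸ relationsLE d` is the
truncated calculus `K_≤d` of route KontsevichZagierPeriods/DimensionBudget; `relations` is the
union of the `relationsLE d` (`relations_eq_iSup_relationsLE`).
[cite: KontsevichZagier2001, §1.2 rules (1)-(3), Conjecture 1] -/
def relationsLE (d : ℕ) : AddSubgroup FormalRep := AddSubgroup.closure (movesLE d)

/-- Two integral representations are *equivalent inside dimension `≤ d`* if one passes from one to
the other by moves among representations of dimension `≤ d`: `[r] − [r'] ∈ relationsLE d`.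
[cite: KontsevichZagier2001, §1.2 Conjecture 1] -/
def EquivalentLE (d : ℕ) (r : IntegralRep n) (r' : IntegralRep m) : Prop :=
  of r - of r' ∈ relationsLE d

/-- `ChainLE d ℓ c`: the formal combination `c` is the sum of a list of at most `ℓ` signed move
instances supported in dimension `≤ d` — a rules-proof of `c ≡ 0` of length `≤ ℓ` inside dimension
`≤ d` (KZ's "amount of ink", §1.2 Problem 2, for the fixed calculus). The balls `ChainLE d ℓ`
exhaust `relationsLE d` (`mem_relationsLE_iff_exists_chainLE`).
[cite: KontsevichZagier2001, §1.2 Problem 2] -/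
def ChainLE (d ℓ : ℕ) (c : FormalRep) : Prop :=
  ∃ l : List FormalRep, l.length ≤ ℓ ∧ (∀ e ∈ l, e ∈ movesLE d ∨ -e ∈ movesLE d) ∧ l.sum = c

/-! ### Unfolding lemmas -/

/-- Unfolding of `formalRepLE`. [cite: KontsevichZagier2001, §1.2] -/
theorem formalRepLE_def (d : ℕ) : formalRepLE d =
    AddSubgroup.closure {x : FormalRep | ∃ (k : ℕ) (s : IntegralRep k), k ≤ d ∧ x = of s} := rfl

/-- Unfolding of `movesLE`. [cite: KontsevichZagier2001, §1.2] -/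
theorem mem_movesLE_iff {d : ℕ} {c : FormalRep} : c ∈ movesLE d ↔
    c ∈ domainAddRel ∪ integrandAddRel ∪ changeOfVariablesRel ∪ newtonLeibnizRel ∧
      c ∈ formalRepLE d := Iff.rfl

/-- Unfolding of `relationsLE`, literally the term inlined by route DimensionBudget.
[cite: KontsevichZagier2001, §1.2] -/
theorem relationsLE_def (d : ℕ) : relationsLE d =
    AddSubgroup.closure ((domainAddRel ∪ integrandAddRel ∪ changeOfVariablesRel ∪
      newtonLeibnizRel) ∩ (AddSubgroup.closure {x : FormalRep | ∃ (k : ℕ) (s : IntegralRep k),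
        k ≤ d ∧ x = of s} : Set FormalRep)) := rfl

/-- Unfolding of `EquivalentLE`. [cite: KontsevichZagier2001, §1.2] -/
theorem equivalentLE_iff {d : ℕ} {r : IntegralRep n} {r' : IntegralRep m} :
    EquivalentLE d r r' ↔ of r - of r' ∈ relationsLE d := Iff.rfl

/-- Unfolding of `ChainLE`. [cite: KontsevichZagier2001, §1.2] -/
theorem chainLE_iff {d ℓ : ℕ} {c : FormalRep} : ChainLE d ℓ c ↔
    ∃ l : List FormalRep, l.length ≤ ℓ ∧ (∀ e ∈ l, e ∈ movesLE d ∨ -e ∈ movesLE d) ∧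
      l.sum = c := Iff.rfl

/-! ### Monotonicity and comparison with `relations` -/

/-- A representation of dimension `k ≤ d` is supported in dimension `≤ d`.
[cite: KontsevichZagier2001, §1.2] -/
theorem of_mem_formalRepLE {k d : ℕ} (s : IntegralRep k) (hk : k ≤ d) : of s ∈ formalRepLE d :=
  AddSubgroup.subset_closure ⟨k, s, hk, rfl⟩

/-- The dimension filtration of `FormalRep` is increasing. [cite: KontsevichZagier2001, §1.2] -/
theorem formalRepLE_mono {d d' : ℕ} (h : d ≤ d') : formalRepLE d ≤ formalRepLE d' :=
  AddSubgroup.closure_mono fun _ ⟨k, s, hk, hx⟩ => ⟨k, s, hk.trans h, hx⟩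

/-- Every formal combination is supported in some dimension. [cite: KontsevichZagier2001, §1.2] -/
theorem mem_iSup_formalRepLE (c : FormalRep) : c ∈ ⨆ d, formalRepLE d := by
  induction c using FreeAbelianGroup.induction_on with
  | zero => exact zero_mem _
  | of x => exact (le_iSup formalRepLE x.1) (of_mem_formalRepLE x.2 le_rfl)
  | neg x hx => exact neg_mem hx
  | add x y hx hy => exact add_mem hx hy

/-- The dimension filtration of `FormalRep` is exhaustive. [cite: KontsevichZagier2001, §1.2] -/
theorem iSup_formalRepLE : ⨆ d, formalRepLE d = ⊤ :=
  eq_top_iff.mpr fun c _ => mem_iSup_formalRepLE c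

/-- Move instances supported in dimension `≤ d` are move instances.
[cite: KontsevichZagier2001, §1.2] -/
theorem movesLE_subset (d : ℕ) :
    movesLE d ⊆ domainAddRel ∪ integrandAddRel ∪ changeOfVariablesRel ∪ newtonLeibnizRel :=
  inter_subset_left

/-- Move instances supported in dimension `≤ d` are supported in dimension `≤ d`.
[cite: KontsevichZagier2001, §1.2] -/
theorem movesLE_subset_formalRepLE (d : ℕ) : movesLE d ⊆ formalRepLE d := inter_subset_right

/-- The truncated move sets increase with `d`. [cite: KontsevichZagier2001, §1.2] -/
theorem movesLE_mono {d d' : ℕ} (h : d ≤ d') : movesLE d ⊆ movesLE d' :=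
  fun _ hc => ⟨hc.1, formalRepLE_mono h hc.2⟩

/-- Move instances supported in dimension `≤ d` are truncated relations.
[cite: KontsevichZagier2001, §1.2] -/
theorem movesLE_subset_relationsLE (d : ℕ) : movesLE d ⊆ relationsLE d :=
  AddSubgroup.subset_closure

/-- A signed move instance supported in dimension `≤ d` is a truncated relation.
[cite: KontsevichZagier2001, §1.2] -/
theorem mem_relationsLE_of_mem_or_neg_mem {d : ℕ} {e : FormalRep}
    (he : e ∈ movesLE d ∨ -e ∈ movesLE d) : e ∈ relationsLE d :=
  he.elim (fun h => movesLE_subset_relationsLE d h)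
    fun h => by simpa using (relationsLE d).neg_mem (movesLE_subset_relationsLE d h)

/-- **Monotonicity** of the truncated relations: `relationsLE d ≤ relationsLE d'` for `d ≤ d'`.
[cite: KontsevichZagier2001, §1.2] -/
theorem relationsLE_mono {d d' : ℕ} (h : d ≤ d') : relationsLE d ≤ relationsLE d' :=
  AddSubgroup.closure_mono (movesLE_mono h)

/-- The truncated relations form a directed family. [cite: KontsevichZagier2001, §1.2] -/
theorem directed_relationsLE : Directed (· ≤ ·) relationsLE :=
  Monotone.directed_le fun _ _ h => relationsLE_mono h

/-- Truncated relations are relations. [cite: KontsevichZagier2001, §1.2] -/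
theorem relationsLE_le_relations (d : ℕ) : relationsLE d ≤ relations :=
  AddSubgroup.closure_mono (movesLE_subset d)

/-- Truncated relations are supported in dimension `≤ d`. [cite: KontsevichZagier2001, §1.2] -/
theorem relationsLE_le_formalRepLE (d : ℕ) : relationsLE d ≤ formalRepLE d :=
  (AddSubgroup.closure_le _).mpr (movesLE_subset_formalRepLE d)

/-- A domain-additivity instance in dimension `n` is supported in dimension `≤ n`.
[cite: KontsevichZagier2001, §1.2 rule (1)] -/
theorem mem_movesLE_of_mem_domainAddRel {c : FormalRep} (hc : c ∈ domainAddRel) :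
    ∃ d, c ∈ movesLE d := by
  obtain ⟨n, r, r₁, r₂, h⟩ := hc
  refine ⟨n, Or.inl (Or.inl (Or.inl ⟨n, r, r₁, r₂, h⟩)), ?_⟩
  rw [h.2.2.2.2]
  exact sub_mem (sub_mem (of_mem_formalRepLE r le_rfl) (of_mem_formalRepLE r₁ le_rfl))
    (of_mem_formalRepLE r₂ le_rfl)

/-- An integrand-additivity instance in dimension `n` is supported in dimension `≤ n`.
[cite: KontsevichZagier2001, §1.2 rule (1)] -/
theorem mem_movesLE_of_mem_integrandAddRel {c : FormalRep} (hc : c ∈ integrandAddRel) :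
    ∃ d, c ∈ movesLE d := by
  obtain ⟨n, r, r₁, r₂, h⟩ := hc
  refine ⟨n, Or.inl (Or.inl (Or.inr ⟨n, r, r₁, r₂, h⟩)), ?_⟩
  rw [h.2.2.2]
  exact sub_mem (sub_mem (of_mem_formalRepLE r le_rfl) (of_mem_formalRepLE r₁ le_rfl))
    (of_mem_formalRepLE r₂ le_rfl)

/-- A change-of-variables instance in dimension `n` is supported in dimension `≤ n`.
[cite: KontsevichZagier2001, §1.2 rule (2)] -/
theorem mem_movesLE_of_mem_changeOfVariablesRel {c : FormalRep} (hc : c ∈ changeOfVariablesRel) :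
    ∃ d, c ∈ movesLE d := by
  obtain ⟨n, r, r', Φ, Φ', h⟩ := hc
  refine ⟨n, Or.inl (Or.inr ⟨n, r, r', Φ, Φ', h⟩), ?_⟩
  rw [h.2.2.2.2.2]
  exact sub_mem (of_mem_formalRepLE r le_rfl) (of_mem_formalRepLE r' le_rfl)

/-- A Newton–Leibniz instance between dimensions `n + 1` and `n` is supported in dimension
`≤ n + 1`. [cite: KontsevichZagier2001, §1.2 rule (3)] -/
theorem mem_movesLE_of_mem_newtonLeibnizRel {c : FormalRep} (hc : c ∈ newtonLeibnizRel) :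
    ∃ d, c ∈ movesLE d := by
  obtain ⟨n, r, r', a, b, F, h⟩ := hc
  refine ⟨n + 1, Or.inr ⟨n, r, r', a, b, F, h⟩, ?_⟩
  rw [h.2.2.2.2.2.2.2.2]
  exact sub_mem (of_mem_formalRepLE r le_rfl) (of_mem_formalRepLE r' (Nat.le_succ n))

/-- Every move instance is supported in some dimension. [cite: KontsevichZagier2001, §1.2] -/
theorem exists_mem_movesLE_of_mem {c : FormalRep}
    (hc : c ∈ domainAddRel ∪ integrandAddRel ∪ changeOfVariablesRel ∪ newtonLeibnizRel) :
    ∃ d, c ∈ movesLE d := by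
  rcases hc with ((h | h) | h) | h
  · exact mem_movesLE_of_mem_domainAddRel h
  · exact mem_movesLE_of_mem_integrandAddRel h
  · exact mem_movesLE_of_mem_changeOfVariablesRel h
  · exact mem_movesLE_of_mem_newtonLeibnizRel h

/-- **Exhaustion**: the dimension filtration exhausts the relations of the KZ calculus,
`relations = ⨆ d, relationsLE d` (every move instance is supported in the dimension of its
representations; conversely `relationsLE d ≤ relations`). This is item `Exhaustion` of route
KontsevichZagierPeriods/DimensionBudget. [cite: KontsevichZagier2001, §1.2] -/
theorem relations_eq_iSup_relationsLE : relations = ⨆ d : ℕ, relationsLE d := by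
  refine le_antisymm ?_ (iSup_le relationsLE_le_relations)
  unfold relations
  refine (AddSubgroup.closure_le _).mpr fun c hc => ?_
  obtain ⟨d, hd⟩ := exists_mem_movesLE_of_mem hc
  exact (le_iSup relationsLE d) (movesLE_subset_relationsLE d hd)

/-- Membership form of exhaustion: a relation is a truncated relation for some `d`.
[cite: KontsevichZagier2001, §1.2] -/
theorem mem_relations_iff_exists_mem_relationsLE {c : FormalRep} :
    c ∈ relations ↔ ∃ d, c ∈ relationsLE d := by
  rw [relations_eq_iSup_relationsLE]
  exact AddSubgroup.mem_iSup_of_directed directed_relationsLE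

/-! ### Chains: the closure is the union of the word-length balls -/

/-- **Word-length balls exhaust the closure**: `c ∈ relationsLE d` iff `c` is the sum of finitely
many signed move instances supported in dimension `≤ d`.
[cite: KontsevichZagier2001, §1.2 Problem 2] -/
theorem mem_relationsLE_iff_exists_chainLE {d : ℕ} {c : FormalRep} :
    c ∈ relationsLE d ↔ ∃ ℓ, ChainLE d ℓ c := by
  constructor
  · intro hc
    have hc' : c ∈ (relationsLE d).toAddSubmonoid := hc
    rw [relationsLE, AddSubgroup.closure_toAddSubmonoid] at hc'
    obtain ⟨L, hL, rfl⟩ := AddSubmonoid.exists_list_of_mem_closure hc'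
    exact ⟨L.length, L, le_rfl, fun e he => (hL e he).imp id fun h => by simpa using h, rfl⟩
  · rintro ⟨ℓ, L, -, hL, rfl⟩
    exact list_sum_mem fun e he => mem_relationsLE_of_mem_or_neg_mem (hL e he)

namespace ChainLE

variable {d d' ℓ ℓ' : ℕ} {c c' : FormalRep}

/-- A chain inside dimension `≤ d` proves a truncated relation.
[cite: KontsevichZagier2001, §1.2] -/
theorem mem_relationsLE (h : ChainLE d ℓ c) : c ∈ relationsLE d :=
  mem_relationsLE_iff_exists_chainLE.mpr ⟨ℓ, h⟩

/-- A chain inside dimension `≤ d` proves a relation. [cite: KontsevichZagier2001, §1.2] -/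
theorem mem_relations (h : ChainLE d ℓ c) : c ∈ relations :=
  relationsLE_le_relations d h.mem_relationsLE

/-- Chains are monotone in the dimension budget and in the length budget.
[cite: KontsevichZagier2001, §1.2] -/
theorem mono (h : ChainLE d ℓ c) (hd : d ≤ d') (hℓ : ℓ ≤ ℓ') : ChainLE d' ℓ' c := by
  obtain ⟨L, hL, hmem, rfl⟩ := h
  exact ⟨L, hL.trans hℓ, fun e he => (hmem e he).imp (fun h => movesLE_mono hd h)
    fun h => movesLE_mono hd h, rfl⟩

/-- The empty chain. [cite: KontsevichZagier2001, §1.2] -/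
theorem zero (d ℓ : ℕ) : ChainLE d ℓ 0 := ⟨[], Nat.zero_le ℓ, fun _ h => by simp at h, rfl⟩

/-- A single move instance is a chain of length `1`. [cite: KontsevichZagier2001, §1.2] -/
theorem of_mem_movesLE (h : c ∈ movesLE d) : ChainLE d 1 c :=
  ⟨[c], le_rfl, fun e he => by simp only [List.mem_singleton] at he; exact Or.inl (he ▸ h),
    by simp⟩

/-- The negative of a single move instance is a chain of length `1`.
[cite: KontsevichZagier2001, §1.2] -/
theorem of_neg_mem_movesLE (h : -c ∈ movesLE d) : ChainLE d 1 c :=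
  ⟨[c], le_rfl, fun e he => by simp only [List.mem_singleton] at he; exact Or.inr (he ▸ h),
    by simp⟩

/-- Concatenation of chains: lengths add. [cite: KontsevichZagier2001, §1.2] -/
theorem add (h : ChainLE d ℓ c) (h' : ChainLE d ℓ' c') : ChainLE d (ℓ + ℓ') (c + c') := by
  obtain ⟨L, hL, hmem, rfl⟩ := h
  obtain ⟨L', hL', hmem', rfl⟩ := h'
  refine ⟨L ++ L', by simpa using Nat.add_le_add hL hL', fun e he => ?_, List.sum_append⟩
  rcases List.mem_append.mp he with he | he
  exacts [hmem e he, hmem' e he]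

/-- Reversal of a chain (same length). [cite: KontsevichZagier2001, §1.2] -/
theorem neg (h : ChainLE d ℓ c) : ChainLE d ℓ (-c) := by
  obtain ⟨L, hL, hmem, rfl⟩ := h
  refine ⟨L.map (negAddMonoidHom : FormalRep →+ FormalRep), by simpa using hL,
    fun e he => ?_, (map_list_sum (negAddMonoidHom : FormalRep →+ FormalRep) L).symm⟩
  obtain ⟨e', he', rfl⟩ := List.mem_map.mp he
  simpa [or_comm] using hmem e' he'

/-- Difference of chains: lengths add. [cite: KontsevichZagier2001, §1.2] -/
theorem sub (h : ChainLE d ℓ c) (h' : ChainLE d ℓ' c') : ChainLE d (ℓ + ℓ') (c - c') := by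
  simpa [sub_eq_add_neg] using h.add h'.neg

end ChainLE

/-! ### Truncated equivalence -/

namespace EquivalentLE

variable {d d' : ℕ}

/-- Truncated equivalence is reflexive. [cite: KontsevichZagier2001, §1.2] -/
@[refl] protected theorem refl (d : ℕ) (r : IntegralRep n) : EquivalentLE d r r := by
  simp [EquivalentLE, (relationsLE d).zero_mem]

/-- Truncated equivalence is symmetric. [cite: KontsevichZagier2001, §1.2] -/
@[symm] protected theorem symm {r : IntegralRep n} {r' : IntegralRep m}
    (h : EquivalentLE d r r') : EquivalentLE d r' r := by
  simpa [EquivalentLE] using (relationsLE d).neg_mem h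

/-- Truncated equivalence is transitive. [cite: KontsevichZagier2001, §1.2] -/
@[trans] protected theorem trans {r : IntegralRep n} {r' : IntegralRep m} {r'' : IntegralRep l}
    (h : EquivalentLE d r r') (h' : EquivalentLE d r' r'') : EquivalentLE d r r'' := by
  simpa [EquivalentLE] using (relationsLE d).add_mem h h'

/-- Truncated equivalence is monotone in the budget. [cite: KontsevichZagier2001, §1.2] -/
theorem mono {r : IntegralRep n} {r' : IntegralRep m} (h : EquivalentLE d r r') (hd : d ≤ d') :
    EquivalentLE d' r r' :=
  relationsLE_mono hd h

/-- Truncated equivalence implies equivalence. [cite: KontsevichZagier2001, §1.2] -/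
theorem equivalent {r : IntegralRep n} {r' : IntegralRep m} (h : EquivalentLE d r r') :
    Equivalent r r' :=
  relationsLE_le_relations d h

/-- A chain from `[r] − [r']` gives a truncated equivalence. [cite: KontsevichZagier2001, §1.2] -/
theorem _root_.Literature.NumberTheory.Transcendental.KZ.ChainLE.equivalentLE {ℓ : ℕ}
    {r : IntegralRep n} {r' : IntegralRep m} (h : ChainLE d ℓ (of r - of r')) :
    EquivalentLE d r r' :=
  h.mem_relationsLE

end EquivalentLE

/-- Two representations are KZ-equivalent iff they are equivalent inside some dimension budget
(exhaustion, membership form). [cite: KontsevichZagier2001, §1.2] -/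
theorem equivalent_iff_exists_equivalentLE {r : IntegralRep n} {r' : IntegralRep m} :
    Equivalent r r' ↔ ∃ d, EquivalentLE d r r' :=
  mem_relations_iff_exists_mem_relationsLE

/-- Truncated equivalence iff a chain of some length exists.
[cite: KontsevichZagier2001, §1.2 Problem 2] -/
theorem equivalentLE_iff_exists_chainLE {d : ℕ} {r : IntegralRep n} {r' : IntegralRep m} :
    EquivalentLE d r r' ↔ ∃ ℓ, ChainLE d ℓ (of r - of r') :=
  mem_relationsLE_iff_exists_chainLE

/-! ### The scaling endomorphism -/

namespace IntegralRep

/-- Scaling of an integral representation by a real algebraic constant `a`: same domain,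
integrand `x ↦ a * f x` (again `ℚ`-semialgebraic since `a` is `ℚ`-definable, KZ §1.1: "rational"
may be replaced by "algebraic"). [cite: KontsevichZagier2001, §1.1] -/
def constMul (a : ℝ) (ha : IsAlgebraic ℚ a) (r : IntegralRep n) : IntegralRep n where
  domain := r.domain
  integrand x := a * r.integrand x
  isSemialgebraic_domain := r.isSemialgebraic_domain
  isSemialgebraicFunOn_integrand :=
    IsSemialgebraicFunOn.mul_holds
      (isSemialgebraicFunOn_const_of_isAlgebraic r.isSemialgebraic_domain ha)
      r.isSemialgebraicFunOn_integrand
  integrableOn := Integrable.const_mul r.integrableOn a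

variable (a : ℝ) (ha : IsAlgebraic ℚ a) (r : IntegralRep n)

/-- The domain of a scaled representation. [cite: KontsevichZagier2001, §1.1] -/
@[simp] theorem domain_constMul : (r.constMul a ha).domain = r.domain := rfl

/-- The integrand of a scaled representation. [cite: KontsevichZagier2001, §1.1] -/
@[simp] theorem integrand_constMul :
    (r.constMul a ha).integrand = fun x => a * r.integrand x := rfl

/-- The value of a scaled representation: `∫_σ a f = a ∫_σ f`.
[cite: KontsevichZagier2001, §1.1] -/
@[simp] theorem value_constMul : (r.constMul a ha).value = a * r.value := by
  simp [value, constMul, integral_const_mul]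

end IntegralRep

/-- The **scaling endomorphism** of `FormalRep` attached to a real algebraic constant `a`: every
representation `[σ, f]` is sent to `[σ, a f]`, additively. It preserves dimensions, every move
set, every `movesLE d` and hence every `relationsLE d` (`scale_mem_relationsLE`), and multiplies
values by `a` (`eval_scale`). [cite: KontsevichZagier2001, §1.2] -/
def scale (a : ℝ) (ha : IsAlgebraic ℚ a) : FormalRep →+ FormalRep :=
  FreeAbelianGroup.map fun s => ⟨s.1, s.2.constMul a ha⟩

section Scale

variable (a : ℝ) (ha : IsAlgebraic ℚ a)

/-- `scale` on a generator. [cite: KontsevichZagier2001, §1.2] -/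
@[simp] theorem scale_of (r : IntegralRep n) : scale a ha (of r) = of (r.constMul a ha) :=
  FreeAbelianGroup.map_of_apply _

/-- `scale` multiplies values by `a`. [cite: KontsevichZagier2001, §1.2] -/
theorem eval_scale (c : FormalRep) : eval (scale a ha c) = a * eval c := by
  have h : eval.comp (scale a ha) = (AddMonoidHom.mulLeft a).comp eval := by
    refine FreeAbelianGroup.lift_ext _ _ fun x => ?_
    obtain ⟨k, s⟩ := x
    change eval (scale a ha (of s)) = a * eval (of s)
    simp
  exact DFunLike.congr_fun h c

/-- `scale` preserves the dimension filtration. [cite: KontsevichZagier2001, §1.2] -/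
theorem scale_mem_formalRepLE {d : ℕ} {c : FormalRep} (hc : c ∈ formalRepLE d) :
    scale a ha c ∈ formalRepLE d := by
  have h : formalRepLE d ≤ (formalRepLE d).comap (scale a ha) :=
    (AddSubgroup.closure_le _).mpr fun x ⟨k, s, hk, hx⟩ => by
      simp only [AddSubgroup.coe_comap, mem_preimage, SetLike.mem_coe, hx, scale_of]
      exact of_mem_formalRepLE _ hk
  exact h hc

/-- `scale` sends domain-additivity instances to domain-additivity instances (same domains,
integrands multiplied by `a`). [cite: KontsevichZagier2001, §1.2 rule (1)] -/
theorem scale_mem_domainAddRel {c : FormalRep} (hc : c ∈ domainAddRel) :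
    scale a ha c ∈ domainAddRel := by
  obtain ⟨n, r, r₁, r₂, hdom, hnull, h₁, h₂, rfl⟩ := hc
  refine ⟨n, r.constMul a ha, r₁.constMul a ha, r₂.constMul a ha, hdom, hnull,
    fun x hx => ?_, fun x hx => ?_, by simp⟩
  · simp only [IntegralRep.integrand_constMul, h₁ hx]
  · simp only [IntegralRep.integrand_constMul, h₂ hx]

/-- `scale` sends integrand-additivity instances to integrand-additivity instances
(`a (f₁ + f₂) = a f₁ + a f₂`). [cite: KontsevichZagier2001, §1.2 rule (1)] -/
theorem scale_mem_integrandAddRel {c : FormalRep} (hc : c ∈ integrandAddRel) :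
    scale a ha c ∈ integrandAddRel := by
  obtain ⟨n, r, r₁, r₂, h₁, h₂, hadd, rfl⟩ := hc
  refine ⟨n, r.constMul a ha, r₁.constMul a ha, r₂.constMul a ha, h₁, h₂, fun x hx => ?_,
    by simp⟩
  simp only [IntegralRep.integrand_constMul, Pi.add_apply, hadd hx, mul_add]

/-- `scale` sends change-of-variables instances to change-of-variables instances (same `Φ`,
`a f = (a f') ∘ Φ · |det Φ'|`). [cite: KontsevichZagier2001, §1.2 rule (2)] -/
theorem scale_mem_changeOfVariablesRel {c : FormalRep} (hc : c ∈ changeOfVariablesRel) :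
    scale a ha c ∈ changeOfVariablesRel := by
  obtain ⟨n, r, r', Φ, Φ', hΦ, hΦ', hinj, hdom, hf, rfl⟩ := hc
  refine ⟨n, r.constMul a ha, r'.constMul a ha, Φ, Φ', hΦ, hΦ', hinj, hdom, fun x hx => ?_,
    by simp⟩
  simp only [IntegralRep.integrand_constMul, hf x hx, mul_assoc]

/-- `scale` sends Newton–Leibniz instances to Newton–Leibniz instances: same band, primitive
`a F` (again `ℚ`-semialgebraic since `a` is algebraic, continuous on the closed fibres, with
derivative `a f` on the open fibres), base integrand `a (F(b) − F(a))`.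
[cite: KontsevichZagier2001, §1.2 rule (3)] -/
theorem scale_mem_newtonLeibnizRel {c : FormalRep} (hc : c ∈ newtonLeibnizRel) :
    scale a ha c ∈ newtonLeibnizRel := by
  obtain ⟨n, r, r', lo, hi, F, hF, hlo, hhi, hle, hdom, hcont, hderiv, hr', rfl⟩ := hc
  refine ⟨n, r.constMul a ha, r'.constMul a ha, lo, hi, fun z => a * F z, ?_, hlo, hhi, hle,
    hdom, fun x hx => ?_, fun x hx t ht => ?_, fun x hx => ?_, by simp⟩
  · exact IsSemialgebraicFunOn.mul_holds
      (isSemialgebraicFunOn_const_of_isAlgebraic r.isSemialgebraic_domain ha) hF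
  · exact continuousOn_const.mul (hcont x hx)
  · exact (hderiv x hx t ht).const_mul a
  · simp only [IntegralRep.integrand_constMul, hr' x hx, mul_sub]

/-- `scale` preserves the set of all move instances. [cite: KontsevichZagier2001, §1.2] -/
theorem scale_mem_moves {c : FormalRep}
    (hc : c ∈ domainAddRel ∪ integrandAddRel ∪ changeOfVariablesRel ∪ newtonLeibnizRel) :
    scale a ha c ∈ domainAddRel ∪ integrandAddRel ∪ changeOfVariablesRel ∪ newtonLeibnizRel := by
  rcases hc with ((h | h) | h) | h
  · exact Or.inl (Or.inl (Or.inl (scale_mem_domainAddRel a ha h)))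
  · exact Or.inl (Or.inl (Or.inr (scale_mem_integrandAddRel a ha h)))
  · exact Or.inl (Or.inr (scale_mem_changeOfVariablesRel a ha h))
  · exact Or.inr (scale_mem_newtonLeibnizRel a ha h)

/-- **The scaling endomorphism preserves `movesLE d`**: a move instance supported in dimension
`≤ d` is sent to a move instance of the same kind supported in dimension `≤ d`.
[cite: KontsevichZagier2001, §1.2] -/
theorem scale_mem_movesLE {d : ℕ} {c : FormalRep} (hc : c ∈ movesLE d) :
    scale a ha c ∈ movesLE d :=
  ⟨scale_mem_moves a ha hc.1, scale_mem_formalRepLE a ha hc.2⟩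

/-- The scaling endomorphism preserves the truncated relations `relationsLE d`.
[cite: KontsevichZagier2001, §1.2] -/
theorem scale_mem_relationsLE {d : ℕ} {c : FormalRep} (hc : c ∈ relationsLE d) :
    scale a ha c ∈ relationsLE d := by
  have h : relationsLE d ≤ (relationsLE d).comap (scale a ha) :=
    (AddSubgroup.closure_le _).mpr fun x hx =>
      movesLE_subset_relationsLE d (scale_mem_movesLE a ha hx)
  exact h hc

/-- The scaling endomorphism preserves `relations`. [cite: KontsevichZagier2001, §1.2] -/
theorem scale_mem_relations {c : FormalRep} (hc : c ∈ relations) : scale a ha c ∈ relations := by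
  obtain ⟨d, hd⟩ := mem_relations_iff_exists_mem_relationsLE.mp hc
  exact relationsLE_le_relations d (scale_mem_relationsLE a ha hd)

/-- The scaling endomorphism maps chains to chains of the same length.
[cite: KontsevichZagier2001, §1.2] -/
theorem ChainLE.scale {d ℓ : ℕ} {c : FormalRep} (h : ChainLE d ℓ c) :
    ChainLE d ℓ (scale a ha c) := by
  obtain ⟨L, hL, hmem, rfl⟩ := h
  refine ⟨L.map (KZ.scale a ha), by simpa using hL, fun e he => ?_,
    (map_list_sum (KZ.scale a ha) L).symm⟩
  obtain ⟨e', he', rfl⟩ := List.mem_map.mp he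
  exact (hmem e' he').imp (fun h => scale_mem_movesLE a ha h)
    fun h => by simpa using scale_mem_movesLE a ha h

/-- Truncated equivalence is preserved by scaling both representations by the same real
algebraic constant. [cite: KontsevichZagier2001, §1.2] -/
theorem EquivalentLE.constMul {d : ℕ} {r : IntegralRep n} {r' : IntegralRep m}
    (h : EquivalentLE d r r') : EquivalentLE d (r.constMul a ha) (r'.constMul a ha) := by
  simpa [EquivalentLE] using scale_mem_relationsLE a ha h

/-- Equivalence is preserved by scaling both representations by the same real algebraic
constant. [cite: KontsevichZagier2001, §1.2] -/
theorem Equivalent.constMul {r : IntegralRep n} {r' : IntegralRep m} (h : Equivalent r r') :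
    Equivalent (r.constMul a ha) (r'.constMul a ha) := by
  simpa [Equivalent] using scale_mem_relations a ha h

end Scale

end KZ

end Literature.NumberTheory.Transcendental
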